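import Summits.HodgeConjecture.HodgeConjecture.Theorems.CyclicUnitaryPowersBlockExtension
import Summits.HodgeConjecture.HodgeConjecture.Theorems.CyclicUnitaryPowersSLTransfer

/-!
# Elements of `U⁰(K)` with determinant-one blocks are products of commutators (step D₂b of crux K2-A)

Helper for stub D₂ `stub_deckUnitaryCommutatorGeneration` of the crux `PowersHodgeOfDeckCommutators`
(stmt-HodgeConjecture-19545, route `CyclicUnitaryPowers`, line `unitary-kunneth-fft` v5, lane 2), step (b4) of
HOME/memos/STUB-PLAN-D2b-Bx.md: **`mem_of_det_block_eq_one`** — if a subgroup `S ≤ GL(W)` contains every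
commutator of elements of `U⁰(K) = centIso σ B` (`σ ^ p = 1`, `p` odd, `ζ` primitive, `B` symmetric nondegenerate
`σ`-invariant, `(2 : K) ≠ 0`), then `S` contains every `γ ∈ U⁰(K)` whose blocks `γ|E_j` (`1 ≤ j ≤ p/2`) have
determinant `1`.  Proof: peel the blocks one at a time with the block extension `ext` (landed
`CyclicUnitaryPowersBlockExtension`), each `ext_j (γ|E_j)` lying in `S` by `CyclicUnitaryPowersSLTransfer`.
-/

noncomputable section

open Module
open scoped BigOperators

namespace Summit.HodgeConjecture.HodgeConjecture.Theorems.CyclicUnitaryPowersDeckUnitaryGeneration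

open Summit.HodgeConjecture.HodgeConjecture.Theorems.CyclicUnitaryPowersSpectralProjectors
open Summit.HodgeConjecture.HodgeConjecture.Theorems.CyclicUnitaryPowersEigenPairing
open Summit.HodgeConjecture.HodgeConjecture.Theorems.CyclicUnitaryPowersDeckUnitaryGroup
open Summit.HodgeConjecture.HodgeConjecture.Theorems.CyclicUnitaryPowersBlockExtension
open Summit.HodgeConjecture.HodgeConjecture.Theorems.CyclicUnitaryPowersSLTransfer

variable {K : Type*} [Field K] [CharZero K] {W : Type*} [AddCommGroup W] [Module K W] [FiniteDimensional K W]
variable {σ : W →ₗ[K] W} {ζ : K} {p : ℕ} {B : LinearMap.BilinForm K W}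

/-! ### §1 Index bookkeeping for `1 ≤ j ≤ p / 2`, `p` odd -/

omit [CharZero K] [FiniteDimensional K W] in
/-- For `p` odd and `1 ≤ j ≤ p/2`: `j < p`, `p - j < p`, `j ≠ p - j`, `0 < p - j`, `p ∣ j + (p - j)`. [folklore] -/
theorem index_facts (hodd : Odd p) {j : ℕ} (hj1 : 1 ≤ j) (hjh : j ≤ p / 2) :
    j < p ∧ p - j < p ∧ j ≠ p - j ∧ 0 < p - j ∧ p ∣ j + (p - j) := by
  obtain ⟨m, rfl⟩ := hodd
  have hdiv : (2 * m + 1) / 2 = m := by omega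
  rw [hdiv] at hjh
  refine ⟨by omega, by omega, by omega, by omega, ?_⟩
  rw [Nat.add_sub_cancel' (by omega)]

/-! ### §2 The restriction of `γ ∈ U⁰(K)` to a block, as an automorphism -/

omit [CharZero K] [FiniteDimensional K W] in
/-- `γ ∈ U⁰(K)` preserves each `E_m`. [folklore] -/
theorem mapsTo_of_mem_centIso {γ : W ≃ₗ[K] W} (hγ : γ ∈ centIso σ B) (m : ℕ) :
    ∀ x ∈ E σ ζ p m, (γ : W →ₗ[K] W) x ∈ E σ ζ p m :=
  mapsTo_range_of_commute (commute_specProj (ζ := ζ) (p := p) (γ : W →ₗ[K] W)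
    (LinearMap.ext fun x => hγ.1 x) m)

/-- The block `γ|E_j` of `γ ∈ U⁰(K)` as an automorphism of `E_j`. [folklore] -/
def block {γ : W ≃ₗ[K] W} (hγ : γ ∈ centIso σ B) (j : ℕ) : E σ ζ p j ≃ₗ[K] E σ ζ p j :=
  LinearEquiv.ofInjectiveEndo ((γ : W →ₗ[K] W).restrict (mapsTo_of_mem_centIso hγ j))
    (fun x y h => Subtype.ext (γ.injective (by simpa using congrArg Subtype.val h)))

omit [CharZero K] in
/-- `block hγ j x = γ x`. [folklore] -/
@[simp] theorem coe_block_apply {γ : W ≃ₗ[K] W} (hγ : γ ∈ centIso σ B) (j : ℕ) (x : E σ ζ p j) :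
    ((block hγ j x : E σ ζ p j) : W) = γ x := rfl

/-- `det (block hγ j) = det (γ ∘ P_j + (1 - P_j))`. [folklore] -/
theorem det_block (hσ : σ ^ p = 1) (hζ : IsPrimitiveRoot ζ p) (hp : 0 < p) {γ : W ≃ₗ[K] W}
    (hγ : γ ∈ centIso σ B) (j : ℕ) :
    LinearMap.det ((block hγ j : E σ ζ p j ≃ₗ[K] E σ ζ p j) : E σ ζ p j →ₗ[K] E σ ζ p j) =
      LinearMap.det ((γ : W →ₗ[K] W) ∘ₗ specProj σ ζ p j + (1 - specProj σ ζ p j)) := by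
  rw [det_comp_specProj_add hσ hζ hp (γ : W →ₗ[K] W) (LinearMap.ext fun x => hγ.1 x) j]
  rfl

/-! ### §3 Multiplicativity of block determinants -/

omit [CharZero K] [FiniteDimensional K W] in
/-- `(γ δ) P + (1 - P) = (γ P + (1 - P)) (δ P + (1 - P))` for `P` idempotent commuting with `δ`. [folklore] -/
theorem block_factor_mul {P γ δ : Module.End K W} (hP : IsIdempotentElem P) (hδ : δ * P = P * δ) :
    (γ * δ) * P + (1 - P) = (γ * P + (1 - P)) * (δ * P + (1 - P)) := by
  have hPP : P * P = P := hP.eq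
  have h1 : γ * P * (δ * P) = γ * δ * P := by
    rw [mul_assoc γ P (δ * P), ← mul_assoc P δ P, ← hδ, mul_assoc δ P P, hPP, ← mul_assoc]
  have h2 : γ * P * (1 - P) = 0 := by rw [mul_assoc, mul_sub, mul_one, hPP, sub_self, mul_zero]
  have h3 : (1 - P) * (δ * P) = 0 := by
    rw [← mul_assoc, sub_mul, one_mul, ← hδ, sub_mul, mul_assoc δ P P, hPP, sub_self]
  have h4 : (1 - P) * (1 - P) = 1 - P := by
    rw [mul_sub, sub_mul, sub_mul, one_mul, mul_one, one_mul, hPP, sub_self, sub_zero]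
  rw [mul_add, add_mul, add_mul, h1, h2, h3, h4, add_zero, zero_add]

omit [FiniteDimensional K W] in
/-- **Block determinants are multiplicative on `U⁰(K)`.** [folklore] -/
theorem det_block_mul (hσ : σ ^ p = 1) (hζ : IsPrimitiveRoot ζ p) (hp : 0 < p) {γ δ : W ≃ₗ[K] W}
    (hδ : δ ∈ centIso σ B) (j : ℕ) :
    LinearMap.det (((γ * δ : W ≃ₗ[K] W) : W →ₗ[K] W) ∘ₗ specProj σ ζ p j + (1 - specProj σ ζ p j)) =
      LinearMap.det ((γ : W →ₗ[K] W) ∘ₗ specProj σ ζ p j + (1 - specProj σ ζ p j)) *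
        LinearMap.det ((δ : W →ₗ[K] W) ∘ₗ specProj σ ζ p j + (1 - specProj σ ζ p j)) := by
  rw [← map_mul, LinearEquiv.coe_toLinearMap_mul, ← Module.End.mul_eq_comp, ← Module.End.mul_eq_comp,
    ← Module.End.mul_eq_comp]
  congr 1
  exact block_factor_mul (isIdempotentElem_specProj hσ hζ hp j)
    (commute_specProj (ζ := ζ) (p := p) (δ : W →ₗ[K] W) (LinearMap.ext fun x => hδ.1 x) j)

/-! ### §4 The block extension as a homomorphism into `GL(W)`, and its blocks -/

section ExtHom

variable (hσ : σ ^ p = 1) (hζ : IsPrimitiveRoot ζ p) (hp : 0 < p) (hB : ∀ x y, B (σ x) (σ y) = B x y)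
  (hBn : B.Nondegenerate) {j : ℕ} (hj : j < p) (hj' : p - j < p) (hjj : p ∣ j + (p - j)) (hne : j ≠ p - j)

/-- `ext` as a monoid homomorphism `GL(E_j) →* GL(W)`. [folklore] -/
def extHom : (E σ ζ p j ≃ₗ[K] E σ ζ p j) →* (W ≃ₗ[K] W) where
  toFun := ext hσ hζ hp hB hBn hj hj' hjj hne
  map_one' := by
    apply LinearEquiv.toLinearMap_injective
    rw [coe_ext, extLin_one hσ hζ hp hB hBn hj hj' hjj hne, LinearEquiv.coe_toLinearMap_one]
    rfl
  map_mul' := ext_mul hσ hζ hp hB hBn hj hj' hjj hne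

/-- Unfolding lemma. [folklore] -/
@[simp] theorem extHom_apply (A : E σ ζ p j ≃ₗ[K] E σ ζ p j) :
    extHom hσ hζ hp hB hBn hj hj' hjj hne A = ext hσ hζ hp hB hBn hj hj' hjj hne A := rfl

end ExtHom

/-! ### §5 Peeling the blocks -/

omit [FiniteDimensional K W] in
/-- Two elements of `U⁰(K)` agreeing on `E_m` for `1 ≤ m ≤ p/2` are equal (`p` odd). [folklore] -/
theorem centIso_ext (hσ : σ ^ p = 1) (hζ : IsPrimitiveRoot ζ p) (hp : 0 < p) (hodd : Odd p)
    (hB : ∀ x y, B (σ x) (σ y) = B x y) (hBn : B.Nondegenerate) {γ γ' : W ≃ₗ[K] W} (hγ : γ ∈ centIso σ B) (hγ' : γ' ∈ centIso σ B)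
    (h : ∀ m, 1 ≤ m → m ≤ p / 2 → ∀ x ∈ E σ ζ p m, γ x = γ' x) : γ = γ' := by
  apply LinearEquiv.toLinearMap_injective
  refine linearMap_ext_of_eigenblocks (σ := σ) hζ hp fun m hm x hx => ?_
  change γ x = γ' x
  by_cases hm0 : m = 0
  · subst hm0
    have hx' : σ x = x := by
      have := apply_of_mem_E hσ hζ hp hx
      rwa [pow_zero, one_smul] at this
    rw [hγ.2.2 x hx', hγ'.2.2 x hx']
  · by_cases hmh : m ≤ p / 2
    · exact h m (Nat.one_le_iff_ne_zero.mpr hm0) hmh x hx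
    · -- `m = p - m'` with `1 ≤ m' ≤ p/2`
      obtain ⟨k, rfl⟩ := hodd
      have hm' : 1 ≤ 2 * k + 1 - m ∧ 2 * k + 1 - m ≤ (2 * k + 1) / 2 := by omega
      have hmeq : m = 2 * k + 1 - (2 * k + 1 - m) := by omega
      rw [hmeq] at hx
      exact centIso_eq_on_opposite hσ hζ hp hB hBn (j := 2 * k + 1 - m) (by omega) hγ hγ'
        (h _ hm'.1 hm'.2) hx

/-- **The peeling induction.** If `S` contains all commutators of `U⁰(K)`, then every `γ ∈ U⁰(K)` whose blocks
`γ|E_j`, `1 ≤ j ≤ p/2`, have determinant `1` and which is the identity on `E_m` for `k < m ≤ p/2` lies in `S`;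
by induction on `k`. [folklore] -/
theorem mem_of_det_block_eq_one_aux (hσ : σ ^ p = 1) (hζ : IsPrimitiveRoot ζ p) (hp : 0 < p) (hodd : Odd p)
    (hB : ∀ x y, B (σ x) (σ y) = B x y) (hBn : B.Nondegenerate) (hBs : ∀ x y, B x y = B y x) (h2 : (2 : K) ≠ 0) (S : Subgroup (W ≃ₗ[K] W))
    (hS : ∀ a ∈ centIso σ B, ∀ b ∈ centIso σ B, a * b * a⁻¹ * b⁻¹ ∈ S) :
    ∀ k : ℕ, ∀ γ : W ≃ₗ[K] W, ∀ hγ : γ ∈ centIso σ B,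
      (∀ j, 1 ≤ j → j ≤ p / 2 →
        LinearMap.det ((γ : W →ₗ[K] W) ∘ₗ specProj σ ζ p j + (1 - specProj σ ζ p j)) = 1) →
      (∀ m, k < m → m ≤ p / 2 → ∀ x ∈ E σ ζ p m, γ x = x) → γ ∈ S := by
  intro k
  induction k with
  | zero =>
    intro γ hγ _ htriv
    have h1 : γ = 1 := centIso_ext hσ hζ hp hodd hB hBn hγ (centIso σ B).one_mem
      (fun m hm1 hmh x hx => by rw [htriv m (by omega) hmh x hx]; rfl)
    rw [h1]; exact S.one_mem
  | succ k ih =>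
    intro γ hγ hdet htriv
    by_cases hk : k + 1 ≤ p / 2
    · -- peel the block `j = k + 1`
      obtain ⟨hj, hj', hne, hj0', hjj⟩ := index_facts hodd (j := k + 1) (by omega) hk
      set A : E σ ζ p (k + 1) ≃ₗ[K] E σ ζ p (k + 1) := block hγ (k + 1) with hA
      set ε : W ≃ₗ[K] W := ext hσ hζ hp hB hBn hj hj' hjj hne A with hε
      have hεU : ε ∈ centIso σ B := ext_mem_centIso hσ hζ hp hB hBn hj hj' hjj hne (by omega) hj0' hBs A
      -- `ε ∈ S` by the `SL` transfer
      have hdetA : LinearMap.det ((A : E σ ζ p (k + 1) ≃ₗ[K] E σ ζ p (k + 1)) :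
          E σ ζ p (k + 1) →ₗ[K] E σ ζ p (k + 1)) = 1 := by
        rw [hA, det_block hσ hζ hp hγ (k + 1)]; exact hdet (k + 1) (by omega) hk
      have hεS : ε ∈ S := by
        have h := map_mem_of_det_eq_one h2 (extHom hσ hζ hp hB hBn hj hj' hjj hne) S
          (fun a b => hS _ (ext_mem_centIso hσ hζ hp hB hBn hj hj' hjj hne (by omega) hj0' hBs a) _
            (ext_mem_centIso hσ hζ hp hB hBn hj hj' hjj hne (by omega) hj0' hBs b)) hdetA
        simpa only [extHom_apply] using h
      -- `δ := γ ε⁻¹` satisfies the hypotheses at level `k`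
      set δ : W ≃ₗ[K] W := γ * ε⁻¹ with hδ
      have hδU : δ ∈ centIso σ B := (centIso σ B).mul_mem hγ ((centIso σ B).inv_mem hεU)
      have hεinvU : ε⁻¹ ∈ centIso σ B := (centIso σ B).inv_mem hεU
      -- values of `ε⁻¹` on the blocks `E_m`, `m ≤ p/2`
      have hεinv_j : ∀ x : E σ ζ p (k + 1), ε⁻¹ (x : W) = (A.symm x : W) := by
        intro x
        apply ε.injective
        rw [← LinearEquiv.mul_apply, mul_inv_cancel]
        change (x : W) = ε (A.symm x : W)
        rw [hε, ext_apply_of_mem hσ hζ hp hB hBn hj hj' hjj hne A (A.symm x), LinearEquiv.apply_symm_apply]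
      have hεinv_other : ∀ m, m < p → m ≠ k + 1 → m ≠ p - (k + 1) → ∀ x ∈ E σ ζ p m, ε⁻¹ x = x := by
        intro m hm hm1 hm2 x hx
        apply ε.injective
        rw [← LinearEquiv.mul_apply, mul_inv_cancel]
        change x = ε x
        rw [hε]
        exact (extLin_apply_of_mem_other hσ hζ hp hB hBn hj hj' hjj A hm hm1 hm2 ⟨x, hx⟩).symm
      have hdetδ : ∀ j, 1 ≤ j → j ≤ p / 2 →
          LinearMap.det ((δ : W →ₗ[K] W) ∘ₗ specProj σ ζ p j + (1 - specProj σ ζ p j)) = 1 := by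
        intro j hj1 hjh
        rw [hδ, det_block_mul hσ hζ hp hεinvU j, hdet j hj1 hjh, one_mul,
          ← det_block hσ hζ hp hεinvU j]
        -- the block of `ε⁻¹` at `j`: `A⁻¹` if `j = k+1`, the identity otherwise
        obtain ⟨hjp, -, hjne, -, -⟩ := index_facts hodd hj1 hjh
        by_cases hjk : j = k + 1
        · subst hjk
          have hblock : (block hεinvU (k + 1) : E σ ζ p (k + 1) ≃ₗ[K] E σ ζ p (k + 1)) = A.symm := by
            apply LinearEquiv.ext; intro x; apply Subtype.ext
            rw [coe_block_apply, hεinv_j x]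
          rw [hblock]
          have hprod : LinearMap.det ((A.symm : E σ ζ p (k + 1) ≃ₗ[K] E σ ζ p (k + 1)) :
              E σ ζ p (k + 1) →ₗ[K] E σ ζ p (k + 1)) *
              LinearMap.det ((A : E σ ζ p (k + 1) ≃ₗ[K] E σ ζ p (k + 1)) :
              E σ ζ p (k + 1) →ₗ[K] E σ ζ p (k + 1)) = 1 := by
            rw [← map_mul, show ((A.symm : E σ ζ p (k + 1) ≃ₗ[K] E σ ζ p (k + 1)) :
                E σ ζ p (k + 1) →ₗ[K] E σ ζ p (k + 1)) * (A : E σ ζ p (k + 1) →ₗ[K] E σ ζ p (k + 1)) = 1 from by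
              ext x; simp, show (1 : Module.End K (E σ ζ p (k + 1))) = LinearMap.id from rfl, LinearMap.det_id]
          rwa [hdetA, mul_one] at hprod
        · have hjne' : j ≠ p - (k + 1) := by
            obtain ⟨m, rfl⟩ := hodd; omega
          have hblock : (block hεinvU j : E σ ζ p j ≃ₗ[K] E σ ζ p j) = 1 := by
            apply LinearEquiv.ext; intro x; apply Subtype.ext
            rw [coe_block_apply, hεinv_other j hjp hjk hjne' x x.2]; rfl
          rw [hblock, LinearEquiv.coe_toLinearMap_one, LinearMap.det_id]
      have htrivδ : ∀ m, k < m → m ≤ p / 2 → ∀ x ∈ E σ ζ p m, δ x = x := by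
        intro m hkm hmh x hx
        rw [hδ, LinearEquiv.mul_apply]
        by_cases hmk : m = k + 1
        · subst hmk
          rw [hεinv_j ⟨x, hx⟩]
          change γ ((A.symm ⟨x, hx⟩ : E σ ζ p (k + 1)) : W) = x
          have := congrArg Subtype.val (A.apply_symm_apply ⟨x, hx⟩)
          rw [coe_block_apply] at this
          exact this
        · have hmp : m < p := by obtain ⟨n, rfl⟩ := hodd; omega
          have hm2 : m ≠ p - (k + 1) := by obtain ⟨n, rfl⟩ := hodd; omega
          rw [hεinv_other m hmp hmk hm2 x hx]
          exact htriv m (by omega) hmh x hx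
      have hδS : δ ∈ S := ih δ hδU hdetδ htrivδ
      have hγeq : γ = δ * ε := by rw [hδ, inv_mul_cancel_right]
      rw [hγeq]
      exact S.mul_mem hδS hεS
    · -- nothing to peel: the triviality hypothesis at level `k` already holds
      exact ih γ hγ hdet (fun m hkm hmh x hx => htriv m (by omega) hmh x hx)

/-- **Elements of `U⁰(K)` with determinant-one blocks are in every subgroup containing the commutators of
`U⁰(K)`** (`p` odd, `B` symmetric nondegenerate `σ`-invariant, `(2 : K) ≠ 0`). [folklore] -/
theorem mem_of_det_block_eq_one (hσ : σ ^ p = 1) (hζ : IsPrimitiveRoot ζ p) (hp : 0 < p) (hodd : Odd p)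
    (hB : ∀ x y, B (σ x) (σ y) = B x y) (hBn : B.Nondegenerate) (hBs : ∀ x y, B x y = B y x) (h2 : (2 : K) ≠ 0) (S : Subgroup (W ≃ₗ[K] W))
    (hS : ∀ a ∈ centIso σ B, ∀ b ∈ centIso σ B, a * b * a⁻¹ * b⁻¹ ∈ S) {γ : W ≃ₗ[K] W} (hγ : γ ∈ centIso σ B)
    (hdet : ∀ j, 1 ≤ j → j < p →
      LinearMap.det ((γ : W →ₗ[K] W) ∘ₗ specProj σ ζ p j + (1 - specProj σ ζ p j)) = 1) : γ ∈ S :=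
  mem_of_det_block_eq_one_aux hσ hζ hp hodd hB hBn hBs h2 S hS (p / 2) γ hγ
    (fun j hj1 hjh => hdet j hj1 (by omega)) (fun m hkm hmh _ _ => absurd hmh (by omega))

end Summit.HodgeConjecture.HodgeConjecture.Theorems.CyclicUnitaryPowersDeckUnitaryGeneration

end
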